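import Literature.NumberTheory.BeurlingPrimes.WellBehavedSystems
import HarnessLib

/-!
# Beurling number systems with prescribed finitely many zeros and poles of the zeta function (Broucke–Debruyne–Révész 2023, Theorem 3.2)

Topic `Literature/NumberTheory/BeurlingPrimes`. GENERALISES the tree's existing vendoring of the same
printed theorem for REAL zeros and poles of multiplicity one,
`Literature.NumberTheory.BeurlingPrimes.BrouckeDebruyneRevesz2023_thm32` (`WellBehavedSystems.lean`,
`R S : Finset ℝ`; consumed by `LindelofWitness.lean`, `WellBehavedCor33/34.lean`), to the printed
generality — finite symmetric multisets of COMPLEX zeros/poles with multiplicities — and PROVES that the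
real multiplicity-one fact is a consequence (`BrouckeDebruyneRevesz2023_thm32_of_multiset`), so that the
two named facts are one debt unit (D-0026). Carriers: the tree's `BeurlingPrimes` with
`intCount = N_P`, `chebyshevPsi = ψ_P`, `zeta = ζ_P` (`Literature/Barriers/RiemannHypothesis/BeurlingCounterexamples`). Source read: F. Broucke, G. Debruyne, Sz. Gy. Révész, *Some
examples of well-behaved Beurling number systems*, arXiv:2309.01567 = Trans. Amer. Math. Soc. 378
(2025), §1 p. 3 (definitions) and §3 pp. 6–7 (Lemma 3.1, Theorem 3.2 with the display following it),
verbatim: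

* §1: "A Beurling generalized number system `(𝒫, 𝒩)` consists of a sequence of generalized primes
  `𝒫 = (p_j)_j` with `1 < p₁ ≤ p₂ ≤ …` and `p_j → ∞`, and the generalized integers `𝒩` which are formed
  by taking the multiplicative semigroup generated by the generalized primes and `1` [footnote: We
  consider generalized integers to be different if their generalized prime factorization is
  different, even if they share the same numerical value] […]
  `π_𝒫(x) = ∑_{p_j ≤ x} 1`, `N_𝒫(x) = ∑_{n_j ≤ x} 1`, `ζ_𝒫(s) = ∑_{n_j} n_j^{-s}` […]
  `ψ_𝒫(x) := ∑_{p_j^k ≤ x} log p_j`."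
* §3: "A multiset `𝒜 = (A, m)` consists of a subset `A` of `ℂ` equipped with a multiplicity function
  `m : A → ℕ`. We say that the multiset is symmetric if `Ā = A` and `m(ā) = m(a)` for every `a ∈ A`.
  In summing over multisets, we sum respective terms according to their multiplicities. Similarly for
  products."
* "**Theorem 3.2.** Let `ℛ`, `𝒮 = (S, m)` be two finite, symmetric, disjoint multisets and
  `Re ω, Re ρ ∈ (0,1)` for all `ω ∈ 𝒮`, `ρ ∈ ℛ`. Then for each `0 < δ < 1/2` there exists a Beurling
  number system `(𝒫, 𝒩)` with the following properties:
  — The Chebyshev prime-counting function satisfies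
    `ψ_𝒫(x) = x + ∑_{ω ∈ 𝒮} x^ω/ω − ∑_{ρ ∈ ℛ} x^ρ/ρ + O(x^δ)`, `x ≥ 1`.
  — The integer-counting function satisfies [footnote: in the sum below, we sum over the underlying
    set `S` and not over the multiset `𝒮`. The function `m` is the multiplicity function of the
    multiset `𝒮`.]
    `N_𝒫(x) = ax + ∑_{ω ∈ S, Re ω > 1/2} x^ω ∑_{j=0}^{m(ω)−1} b_{ω,j} (log x)^j + O{x^{1/2} exp(c(log x)^{2/3})}`,
    `x ≥ 2`, for certain constants `a > 0`, `b_{ω,j} ∈ ℂ` and `c > 0`, with `b_{ω̄,j} = \overline{b_{ω,j}}`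
    and `b_{ω,m(ω)−1} ≠ 0`.
  We note that the associated zeta function `ζ_𝒫(s)` of the system from the proof is given by
  `ζ_𝒫(s) = E(s) e^{Z(s)}`, where
  `E(s) = E_M(s) := s/(s−1) ∏_{ω ∈ 𝒮} (s/(s−ω)) ∏_{ρ ∈ ℛ} ((s−ρ)/s) (s/(s−δ))^M`
  for a sufficiently large integer `M`, and `Z(s)` is a function holomorphic on `Re s > 0` which
  satisfies `Z(σ + it) ≪ σ/(σ − 1/2) + σ √(log(|t|+1)/(σ − 1/2))`, for `σ > 1/2`.
  In particular, `ζ_𝒫(s)` has meromorphic continuation to the half-plane `Re s > 0`, its zeros in this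
  half-plane are precisely the elements of `ℛ` (with matching multiplicities), and its poles in this
  half-plane are precisely the elements of `𝒮 ∪ {1} ∪ {δ}^M`."
  (§1, notation: "if we write `f(x) ≪ g(x)`, the implicit constant only has to be independent of `x`,
  but is allowed to depend on other parameters appearing in the context.")

## Lean rendering (real definitions of the tree only)

Multisets are Mathlib `Multiset ℂ` ("summing according to multiplicities" = `Multiset.map`/`.sum`,
`.prod`; the underlying set is `.toFinset`, the multiplicity is `.count`); symmetric =
`R.map conj = R`; disjoint = `Disjoint R S`. The system is the tree's `BeurlingPrimes` (`1 < p₀`,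
monotone, `→ ∞`; §1 verbatim), with `chebyshevPsi`, `intCount` (generalized integers counted by
factorisation = exponent vectors, exactly the footnote's convention) and `zeta` (the Dirichlet series,
used only on `Re s > 1`). `x^ω` is the principal complex power `(x : ℂ) ^ ω` (`= e^{ω log x}`, `x ≥ 1`).
`O(·)` on `x ≥ 1` / `x ≥ 2` and `≪` for `σ > 1/2` are rendered as global bounds with one constant per
system (as printed: the ranges are part of the statement, and the implied constant of `≪` is
independent of `σ` and `t`). `E_M` is the explicit rational function `bdrE R S δ M`. The identity
`ζ_𝒫 = E_M e^Z` is asserted on `Re s > 1`, where the tree's `zeta` is the convergent series; together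
with "`Z` holomorphic on `Re s > 0`" it IS the meromorphic continuation, so the printed "In
particular" sentence (zeros exactly `ℛ`, poles exactly `𝒮 ∪ {1} ∪ {δ}^M` — read with the obvious
proviso `δ ∉ ℛ`) is a consequence and is not restated as a separate clause. "For a sufficiently large
integer `M`" is the existential `∃ M`. The Lindelöf-type growth `|ζ_𝒫(σ+it)| ≪_{σ₀,ε} |t|^ε`
(`σ ≥ σ₀ > 1/2`) wanted by the consumer (route `RiemannHypothesis/LindelofBridge`, item
`BeurlingLindelofWitness`) follows from `|e^{Z}| ≤ e^{|Z|}` and the bound (`e^{C√log|t|} ≪_ε |t|^ε`)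
on vertical strips, plus the trivial bound of the Dirichlet series far to the right; for a REAL zero
`ρ₀` that derivation is the tree's `BrouckeDebruyneRevesz2023_thm32.lindelofWitness` (`LindelofWitness.lean`,
proved from the real fact, hence — through the bridge below — from this one). Proved here: the
bridge to the real multiplicity-one fact; the specialisation to one conjugate pair of (possibly
non-real) zeros and no poles (`….pair`, `ℛ = {ρ₀, ρ̄₀}`, `𝒮 = ∅`), and the shape of `E_M` there.

## References

* [BrouckeDebruyneRevesz2023] F. Broucke, G. Debruyne, Sz. Gy. Révész, Some examples of well-behaved
  Beurling number systems, arXiv:2309.01567; Trans. Amer. Math. Soc. 378 (2025),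
  doi:10.1090/tran/9274 — §1 (definitions), §3 Lemma 3.1, Theorem 3.2 and the display after it.
* [Revesz2022] cited there as the case `𝒮 = ∅` (Theorem 7.4); not used.
-/

noncomputable section

open Complex Filter Topology

namespace Literature.NumberTheory.BeurlingPrimes

open Literature.Barriers.RiemannHypothesis

/-- **The explicit factor `E_M(s)` of Theorem 3.2**:
`E_M(s) = s/(s−1) · ∏_{ω ∈ 𝒮} s/(s−ω) · ∏_{ρ ∈ ℛ} (s−ρ)/s · (s/(s−δ))^M` (products over the
multisets, with multiplicity). [cite: BrouckeDebruyneRevesz2023, Theorem 3.2 (display for E_M)] -/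
def bdrE (R S : Multiset ℂ) (δ : ℝ) (M : ℕ) (s : ℂ) : ℂ :=
  s / (s - 1) * (S.map fun ω ↦ s / (s - ω)).prod * (R.map fun ρ ↦ (s - ρ) / s).prod *
    (s / (s - δ)) ^ M

/-- With no poles prescribed and the zeros `ℛ = {ρ₀, ρ̄₀}`:
`E_M(s) = s/(s−1) · ((s−ρ₀)/s) ((s−ρ̄₀)/s) · (s/(s−δ))^M`.
[cite: BrouckeDebruyneRevesz2023, Theorem 3.2 (display for E_M)] -/
theorem bdrE_pair (ρ₀ : ℂ) (δ : ℝ) (M : ℕ) (s : ℂ) :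
    bdrE {ρ₀, starRingEnd ℂ ρ₀} ∅ δ M s =
      s / (s - 1) * ((s - ρ₀) / s * ((s - starRingEnd ℂ ρ₀) / s)) * (s / (s - δ)) ^ M := by
  simp [bdrE, Multiset.insert_eq_cons]

/-- **Broucke–Debruyne–Révész 2023, Theorem 3.2 (with the structure `ζ_𝒫 = E_M e^Z` and the bound
on `Z` displayed after it): Beurling number systems whose zeta function has prescribed finitely many
zeros and poles in `0 < Re s < 1`.** For finite symmetric disjoint multisets `ℛ` (zeros) and `𝒮`
(poles) of complex numbers with real parts in `(0,1)`, and `0 < δ < 1/2`, there is a Beurling number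
system `𝒫` (tree `BeurlingPrimes`), constants `a > 0`, `c > 0`, `b_{ω,j} ∈ ℂ` (`b_{ω̄,j} = \overline{b_{ω,j}}`,
`b_{ω,m(ω)−1} ≠ 0` for `ω ∈ 𝒮` with `Re ω > 1/2`), an integer `M` and `Z : ℂ → ℂ` such that
`ψ_𝒫(x) = x + ∑_{ω∈𝒮} x^ω/ω − ∑_{ρ∈ℛ} x^ρ/ρ + O(x^δ)` (`x ≥ 1`),
`N_𝒫(x) = ax + ∑_{ω ∈ S, Re ω > 1/2} x^ω ∑_{j < m(ω)} b_{ω,j}(log x)^j + O(x^{1/2} exp(c(log x)^{2/3}))`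
(`x ≥ 2`; sum over the underlying SET `S` of `𝒮`, `m` its multiplicity), `ζ_𝒫(s) = E_M(s) e^{Z(s)}`
on `Re s > 1` with `E_M = bdrE ℛ 𝒮 δ M`, `Z` holomorphic on `Re s > 0`, and
`|Z(σ+it)| ≤ C (σ/(σ−1/2) + σ √(log(|t|+1)/(σ−1/2)))` for all `σ > 1/2`, `t ∈ ℝ` (one constant `C`).
Statement only (proof: template system `F = li + ∑ li(x^ω) − ∑ li(x^ρ) + M li(x^δ)`, Lemma 3.1, and
the Broucke–Vindas discretization theorem). [cite: BrouckeDebruyneRevesz2023, Theorem 3.2 and the display following it] -/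
def BrouckeDebruyneRevesz2023_thm32_multiset : Prop :=
  ∀ (R S : Multiset ℂ) (δ : ℝ),
    R.map (starRingEnd ℂ) = R → S.map (starRingEnd ℂ) = S → Disjoint R S →
    (∀ ρ ∈ R, 0 < ρ.re ∧ ρ.re < 1) → (∀ ω ∈ S, 0 < ω.re ∧ ω.re < 1) →
    0 < δ → δ < 1 / 2 →
    ∃ (P : BeurlingPrimes) (a c : ℝ) (b : ℂ → ℕ → ℂ) (M : ℕ) (Z : ℂ → ℂ),
      0 < a ∧ 0 < c ∧
      -- ψ_𝒫(x) = x + ∑_{ω∈𝒮} x^ω/ω − ∑_{ρ∈ℛ} x^ρ/ρ + O(x^δ), x ≥ 1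
      (∃ C : ℝ, ∀ x : ℝ, 1 ≤ x →
        ‖(P.chebyshevPsi x : ℂ) -
            ((x : ℂ) + (S.map fun ω ↦ (x : ℂ) ^ ω / ω).sum - (R.map fun ρ ↦ (x : ℂ) ^ ρ / ρ).sum)‖ ≤
          C * x ^ δ) ∧
      -- the constants b_{ω,j}
      (∀ ω ∈ S, ∀ j : ℕ, b (starRingEnd ℂ ω) j = starRingEnd ℂ (b ω j)) ∧
      (∀ ω ∈ S, 1 / 2 < ω.re → b ω (S.count ω - 1) ≠ 0) ∧
      -- N_𝒫(x) = ax + ∑_{ω ∈ S, Re ω > 1/2} x^ω ∑_{j < m(ω)} b_{ω,j} (log x)^j + O(x^{1/2} e^{c (log x)^{2/3}}), x ≥ 2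
      (∃ C : ℝ, ∀ x : ℝ, 2 ≤ x →
        ‖(P.intCount x : ℂ) -
            (((a * x : ℝ) : ℂ) + ∑ ω ∈ S.toFinset.filter (fun ω ↦ 1 / 2 < ω.re),
              (x : ℂ) ^ ω * ∑ j ∈ Finset.range (S.count ω), b ω j * ((Real.log x : ℝ) : ℂ) ^ j)‖ ≤
          C * (x ^ (1 / 2 : ℝ) * Real.exp (c * Real.log x ^ (2 / 3 : ℝ)))) ∧
      -- ζ_𝒫 = E_M e^Z on Re s > 1; Z holomorphic on Re s > 0; the bound for σ > 1/2
      (∀ s : ℂ, 1 < s.re → P.zeta s = bdrE R S δ M s * Complex.exp (Z s)) ∧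
      DifferentiableOn ℂ Z {s : ℂ | 0 < s.re} ∧
      (∃ C : ℝ, ∀ σ t : ℝ, 1 / 2 < σ →
        ‖Z (σ + t * Complex.I)‖ ≤
          C * (σ / (σ - 1 / 2) + σ * Real.sqrt (Real.log (|t| + 1) / (σ - 1 / 2))))

/-- **The consumer's configuration: one conjugate pair of zeros, no poles** (route
`RiemannHypothesis/LindelofBridge`, item `BeurlingLindelofWitness`: `ℛ = {ρ₀, ρ̄₀}`, `𝒮 = ∅`). For
`0 < Re ρ₀ < 1` and `0 < δ < 1/2` there is a Beurling number system with
`ψ_𝒫(x) = x − x^{ρ₀}/ρ₀ − x^{ρ̄₀}/ρ̄₀ + O(x^δ)`, `N_𝒫(x) = ax + O(x^{1/2} exp(c(log x)^{2/3}))` (`a > 0`),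
`ζ_𝒫(s) = s/(s−1)·((s−ρ₀)/s)((s−ρ̄₀)/s)(s/(s−δ))^M · e^{Z(s)}` on `Re s > 1`, `Z` holomorphic on
`Re s > 0` and `|Z(σ+it)| ≤ C(σ/(σ−1/2) + σ√(log(|t|+1)/(σ−1/2)))` for `σ > 1/2` — so the continued
zeta function is holomorphic on `{Re s > 0} ∖ {1, δ}` and vanishes there exactly at `ρ₀, ρ̄₀`.
[cite: BrouckeDebruyneRevesz2023, Theorem 3.2] -/
theorem BrouckeDebruyneRevesz2023_thm32_multiset.pair (h : BrouckeDebruyneRevesz2023_thm32_multiset) (ρ₀ : ℂ)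
    (hρ₀ : 0 < ρ₀.re) (hρ₀' : ρ₀.re < 1) {δ : ℝ} (hδ : 0 < δ) (hδ' : δ < 1 / 2) :
    ∃ (P : BeurlingPrimes) (a c : ℝ) (M : ℕ) (Z : ℂ → ℂ), 0 < a ∧ 0 < c ∧
      (∃ C : ℝ, ∀ x : ℝ, 1 ≤ x →
        ‖(P.chebyshevPsi x : ℂ) -
            ((x : ℂ) - ((x : ℂ) ^ ρ₀ / ρ₀ + (x : ℂ) ^ (starRingEnd ℂ ρ₀) / starRingEnd ℂ ρ₀))‖ ≤
          C * x ^ δ) ∧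
      (∃ C : ℝ, ∀ x : ℝ, 2 ≤ x →
        ‖(P.intCount x : ℂ) - ((a * x : ℝ) : ℂ)‖ ≤
          C * (x ^ (1 / 2 : ℝ) * Real.exp (c * Real.log x ^ (2 / 3 : ℝ)))) ∧
      (∀ s : ℂ, 1 < s.re →
        P.zeta s = s / (s - 1) * ((s - ρ₀) / s * ((s - starRingEnd ℂ ρ₀) / s)) * (s / (s - δ)) ^ M *
          Complex.exp (Z s)) ∧
      DifferentiableOn ℂ Z {s : ℂ | 0 < s.re} ∧
      (∃ C : ℝ, ∀ σ t : ℝ, 1 / 2 < σ →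
        ‖Z (σ + t * Complex.I)‖ ≤
          C * (σ / (σ - 1 / 2) + σ * Real.sqrt (Real.log (|t| + 1) / (σ - 1 / 2)))) := by
  have hsymm : ({ρ₀, starRingEnd ℂ ρ₀} : Multiset ℂ).map (starRingEnd ℂ) = {ρ₀, starRingEnd ℂ ρ₀} := by
    simp only [Multiset.insert_eq_cons, Multiset.map_cons, Multiset.map_singleton, Complex.conj_conj]
    exact Multiset.cons_swap _ _ _
  have hre : ∀ ρ ∈ ({ρ₀, starRingEnd ℂ ρ₀} : Multiset ℂ), 0 < ρ.re ∧ ρ.re < 1 := by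
    intro ρ hρ
    simp only [Multiset.insert_eq_cons, Multiset.mem_cons, Multiset.mem_singleton] at hρ
    rcases hρ with rfl | rfl
    · exact ⟨hρ₀, hρ₀'⟩
    · rw [Complex.conj_re]; exact ⟨hρ₀, hρ₀'⟩
  obtain ⟨P, a, c, b, M, Z, ha, hc, ⟨C₁, hψ⟩, -, -, ⟨C₂, hN⟩, hζ, hZ, hbound⟩ :=
    h {ρ₀, starRingEnd ℂ ρ₀} ∅ δ hsymm (by simp) (by simp) hre (by simp) hδ hδ'
  refine ⟨P, a, c, M, Z, ha, hc, ⟨C₁, fun x hx ↦ ?_⟩, ⟨C₂, fun x hx ↦ ?_⟩, fun s hs ↦ ?_, hZ, hbound⟩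
  · have := hψ x hx
    simpa [Multiset.insert_eq_cons, sub_eq_add_neg, add_assoc] using this
  · have := hN x hx
    simpa using this
  · rw [hζ s hs, bdrE_pair]

/-! ### The real, multiplicity-one vendoring is a consequence -/

/-- Multisets of reals viewed in `ℂ` are symmetric. [folklore] -/
theorem map_conj_map_ofReal (T : Multiset ℝ) :
    (T.map ((↑) : ℝ → ℂ)).map (starRingEnd ℂ) = T.map ((↑) : ℝ → ℂ) := by
  rw [Multiset.map_map]
  exact Multiset.map_congr rfl fun r _ ↦ Complex.conj_ofReal r

/-- A complex number fixed by conjugation is the cast of its real part. [folklore] -/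
theorem eq_ofReal_re_of_conj_eq {z : ℂ} (hz : starRingEnd ℂ z = z) : z = (z.re : ℂ) :=
  (Complex.conj_eq_iff_re.1 hz).symm

/-- **The tree's real, multiplicity-one vendoring of Theorem 3.2
(`Literature.NumberTheory.BeurlingPrimes.BrouckeDebruyneRevesz2023_thm32`, `WellBehavedSystems.lean`)
follows from the multiset form**: take `ℛ`, `𝒮 ⊂ (0,1) ⊂ ℝ` as multisets of complex numbers with all
multiplicities one; symmetry is automatic, `x^ω` is real (`Complex.ofReal_cpow`), the top (only)
coefficient `b_{ω,0}` is real by `b_{ω̄,0} = \overline{b_{ω,0}}` and non-zero. Hence the two named facts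
are ONE unit of debt. [cite: BrouckeDebruyneRevesz2023, Theorem 3.2] -/
theorem BrouckeDebruyneRevesz2023_thm32_of_multiset (h : BrouckeDebruyneRevesz2023_thm32_multiset) :
    BrouckeDebruyneRevesz2023_thm32 := by
  intro R S δ hRS hR hS hδ hδ'
  set R' : Multiset ℂ := R.val.map ((↑) : ℝ → ℂ) with hR'
  set S' : Multiset ℂ := S.val.map ((↑) : ℝ → ℂ) with hS'
  have memR' : ∀ {ρ : ℂ}, ρ ∈ R' → ∃ r ∈ R, (r : ℂ) = ρ := fun hρ ↦ by
    obtain ⟨r, hr, rfl⟩ := Multiset.mem_map.1 hρ; exact ⟨r, hr, rfl⟩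
  have memS' : ∀ {ω : ℂ}, ω ∈ S' → ∃ r ∈ S, (r : ℂ) = ω := fun hω ↦ by
    obtain ⟨r, hr, rfl⟩ := Multiset.mem_map.1 hω; exact ⟨r, hr, rfl⟩
  have hdisj : Disjoint R' S' := by
    rw [Multiset.disjoint_left]
    intro a haR haS
    obtain ⟨r, hr, rfl⟩ := memR' haR
    obtain ⟨t, ht, hrt⟩ := memS' haS
    obtain rfl : t = r := Complex.ofReal_injective hrt
    exact Finset.disjoint_left.1 hRS hr ht
  have hR'' : ∀ ρ ∈ R', 0 < ρ.re ∧ ρ.re < 1 := fun ρ hρ ↦ by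
    obtain ⟨r, hr, rfl⟩ := memR' hρ; simpa using hR r hr
  have hS'' : ∀ ω ∈ S', 0 < ω.re ∧ ω.re < 1 := fun ω hω ↦ by
    obtain ⟨r, hr, rfl⟩ := memS' hω; simpa using hS r hr
  obtain ⟨P, a, c, b, M, Z, ha, hc, ⟨C₁, hψ⟩, hbsymm, hbne, ⟨C₂, hN⟩, hζ, hZ, ⟨K, hbound⟩⟩ :=
    h R' S' δ (map_conj_map_ofReal R.val) (map_conj_map_ofReal S.val) hdisj hR'' hS'' hδ hδ'
  -- realness of the coefficients `b_{ω,0}` for `ω ∈ S`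
  have hbreal : ∀ ω ∈ S, b (ω : ℂ) 0 = ((b (ω : ℂ) 0).re : ℂ) := fun ω hω ↦ by
    refine eq_ofReal_re_of_conj_eq ?_
    have := hbsymm (ω : ℂ) (Multiset.mem_map_of_mem _ hω) 0
    rw [Complex.conj_ofReal] at this
    exact this.symm
  have hcount : ∀ ω ∈ S, S'.count (ω : ℂ) = 1 := fun ω hω ↦ by
    rw [hS', Multiset.count_map_eq_count' _ _ Complex.ofReal_injective]
    exact Multiset.count_eq_one_of_mem S.nodup hω
  refine ⟨P, ⟨C₁, fun x hx ↦ ?_⟩,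
    ⟨a, c, C₂, fun ω ↦ (b (ω : ℂ) 0).re, ha, hc, fun ω hω hω' ↦ ?_, fun x hx ↦ ?_⟩,
    ⟨M, Z, K, hZ, fun s hs ↦ ?_, fun s hs ↦ ?_⟩⟩
  · -- ψ-clause
    have hx0 : (0 : ℝ) ≤ x := zero_le_one.trans hx
    have eS : (S'.map fun ω ↦ (x : ℂ) ^ ω / ω).sum = ((∑ ω ∈ S, x ^ ω / ω : ℝ) : ℂ) := by
      rw [Complex.ofReal_sum, Finset.sum_eq_multiset_sum, hS', Multiset.map_map]
      exact congrArg _ (Multiset.map_congr rfl fun ω _ ↦ by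
        simp [Function.comp, Complex.ofReal_div, Complex.ofReal_cpow hx0])
    have eR : (R'.map fun ρ ↦ (x : ℂ) ^ ρ / ρ).sum = ((∑ ρ ∈ R, x ^ ρ / ρ : ℝ) : ℂ) := by
      rw [Complex.ofReal_sum, Finset.sum_eq_multiset_sum, hR', Multiset.map_map]
      exact congrArg _ (Multiset.map_congr rfl fun ρ _ ↦ by
        simp [Function.comp, Complex.ofReal_div, Complex.ofReal_cpow hx0])
    have := hψ x hx
    rw [eS, eR] at this
    have e3 : (P.chebyshevPsi x : ℂ) -
        ((x : ℂ) + ((∑ ω ∈ S, x ^ ω / ω : ℝ) : ℂ) - ((∑ ρ ∈ R, x ^ ρ / ρ : ℝ) : ℂ)) =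
        ((P.chebyshevPsi x - (x + ∑ ω ∈ S, x ^ ω / ω - ∑ ρ ∈ R, x ^ ρ / ρ) : ℝ) : ℂ) := by
      push_cast; ring
    rwa [e3, Complex.norm_real, Real.norm_eq_abs] at this
  · -- the top coefficient is non-zero
    have h1 := hbne (ω : ℂ) (Multiset.mem_map_of_mem _ hω) (by simpa using hω')
    rw [hcount ω hω, Nat.sub_self, hbreal ω hω] at h1
    intro h0
    have h0' : (b (ω : ℂ) 0).re = 0 := h0
    exact h1 (by rw [h0', Complex.ofReal_zero])
  · -- N-clause
    have hx0 : (0 : ℝ) ≤ x := zero_le_two.trans hx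
    have hinj : Set.InjOn ((↑) : ℝ → ℂ) ↑(S.filter fun ω ↦ 1 / 2 < ω) :=
      Complex.ofReal_injective.injOn
    have eS : ∑ ω ∈ S'.toFinset.filter (fun ω ↦ 1 / 2 < ω.re),
        (x : ℂ) ^ ω * ∑ j ∈ Finset.range (S'.count ω), b ω j * ((Real.log x : ℝ) : ℂ) ^ j =
        ((∑ ω ∈ S with 1 / 2 < ω, (b (ω : ℂ) 0).re * x ^ ω : ℝ) : ℂ) := by
      have hset : S'.toFinset.filter (fun ω ↦ 1 / 2 < ω.re) =
          (S.filter fun ω ↦ 1 / 2 < ω).image ((↑) : ℝ → ℂ) := by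
        rw [hS', Multiset.toFinset_map, Finset.val_toFinset, Finset.filter_image]
        rfl
      rw [hset, Finset.sum_image hinj, Complex.ofReal_sum]
      refine Finset.sum_congr rfl fun ω hω ↦ ?_
      have hωS : ω ∈ S := (Finset.mem_filter.1 hω).1
      have hb := hbreal ω hωS
      rw [hcount ω hωS, Finset.sum_range_one, pow_zero, mul_one, Complex.ofReal_mul,
        Complex.ofReal_cpow hx0, ← hb, mul_comm]
    have := hN x hx
    rw [eS] at this
    have e3 : (P.intCount x : ℂ) -
        (((a * x : ℝ) : ℂ) + ((∑ ω ∈ S with 1 / 2 < ω, (b (ω : ℂ) 0).re * x ^ ω : ℝ) : ℂ)) =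
        (((P.intCount x : ℝ) - (a * x + ∑ ω ∈ S with 1 / 2 < ω, (b (ω : ℂ) 0).re * x ^ ω) : ℝ) : ℂ) := by
      push_cast; ring
    rwa [e3, Complex.norm_real, Real.norm_eq_abs] at this
  · -- the bound on `Z`
    have := hbound s.re s.im hs
    rwa [Complex.re_add_im] at this
  · -- `ζ_𝒫 = E_M e^Z`
    rw [hζ s hs, bdrE, hS', hR', Multiset.map_map, Multiset.map_map, Finset.prod_eq_multiset_prod,
      Finset.prod_eq_multiset_prod]
    rfl

end Literature.NumberTheory.BeurlingPrimes

end
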